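import Literature.Computability.AlgebraicComplexity.MoreAsymmetricHoles
import Literature.Computability.AlgebraicComplexity.GlobalStageAssembly
import HarnessLib

/-!
# The more asymmetric global stage, region 1, assembled in exact form: the power restricts to
independent copies of the interface tensor `𝒯*`
(Alman–Duan–Vassilevska Williams–Xu–Xu–Zhou 2025, Prop. 5.1 / §5.5–§5.6, one region) — proved

Topic `Literature/Computability/AlgebraicComplexity`.  Alman–Duan–Vassilevska Williams–Xu–Xu–Zhou,
*More asymmetry yields faster matrix multiplication* (SODA 2025, arXiv:2404.16349), end of §5.5:
"in expectation, we obtain `numalpha · M^{-1-o(1)}` independent broken copies of `𝒯*` with `≤ 1/8N`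
fraction of holes, and by Theorem 4.2 [VXXZ24, fixing holes], we can degenerate them into
`numalpha · M^{-1-o(1)}` unbroken copies of `𝒯*`"; §5.6 "Summary": "the above algorithm degenerates
`(CW_q^{⊗2^{ℓ−1}})^{⊗A₁n}` into `numalpha · M₀^{-1-o(1)} ≥ 2^{A₁n · min{H(α_X) − P_α, H(β̄_Y) − η_Y, H(β̄_Z) − λ_Z} − o(n)}`
independent copies of a level-`ℓ` interface tensor `𝒯*`" — the first region of **Proposition 5.1**.
This file PROVES the assembly in EXACT (non-asymptotic) form, for the data `D` of one region and a
seed `ω`, exactly as `GlobalStageAssembly.lean` does for VXXZ 2024 (whose copies have `Z`-holes only):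

* `MoreAsym.brokenCopy_restrictsTo_refCopy` — a broken copy of `𝒯*_T` with `Y`-holes `H_Y` and `Z`-holes
  `H_Z` restricts to a broken copy of the reference `𝒯*_{T₀}` (`T, T₀ ∈ 𝒯α`) with hole sets of the same
  sizes (relabelling the chunks, `InterfaceRelabel.lean`);
* `MoreAsym.power_restrictsTo_copies` — **for every `k, r` with `k · r ≤ #{T ∈ 𝒯_hash(ω) | |holesY_ω T| ≤ h_Y,
  |holesZ_ω T| ≤ h_Z}`, `r ≥ 8^{3⌊log_{2N} 3^N⌋+3}` (`N = cn`) and hole budgets `8 N h_Y ≤ M_Y`,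
  `8 N h_Z ≤ M_Z` (the numbers of level-1 `Y`-, `Z`-blocks of `𝒯*`): `(CW_q^{⊗c})^{⊗n} ≥ ⟨k⟩ ⊗ 𝒯*`** —
  zero-out to `𝒯_ZUseful` (`MoreAsymmetricStructure.lean`), the direct-sum decomposition, `k` batches of
  `r` good broken copies, and VXXZ's hole-fixing Cor. 4.2 = ADVXXZ Thm. 4.2 (`vxxz2024_cor42`, which
  fixes holes in all three dimensions) on each batch;
* `advxxz2025_prop51_region` — combined with the good seed of `MoreAsymmetricHoles.lean`
  (`MoreAsym.exists_seed_many_good_copies`): under the requirements on `M` (cleanup in `X`, `Y`-holes,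
  `Z`-holes), `(CW_q^{⊗c})^{⊗n} ≥ ⟨⌊|B| |𝒯α| / (2 M² r)⌋⟩ ⊗ 𝒯*_{T₀}` for every reference triple `T₀ ∈ 𝒯α`
  — the printed count `numalpha · |B| · (3/4) · M^{-2}` of surviving copies divided by the
  `r = 2^{O(N/log N)}` of Thm. 4.2, i.e. `numalpha · M₀^{-1-o(1)}` copies.

Everything is proved; no new definitions besides the abbreviations `MoreAsym.goodTriples`,
`usefulYCount`; no named facts.  Choosing `M`, `B` and turning the count into the exponent
`min{H(α_X) − P_α, H(β̄_Y) − η_Y, H(β̄_Z) − λ_Z}` (Claims 5.4, 5.17, 5.19), the six regions (§5.1) and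
the `ε`-version (Thm. 5.3) are not part of this file.

## References

* J. Alman, R. Duan, V. Vassilevska Williams, Y. Xu, Z. Xu, R. Zhou, *More asymmetry yields faster
  matrix multiplication*, SODA 2025, arXiv:2404.16349 (held: `paper:arxiv-2404.16349`, chunk p0020):
  Prop. 5.1, §5.5 (last paragraph), §5.6 (Summary), Thm. 4.2. [AlmanDuanVassilevskaWilliamsXuXuZhou2025]
* V. Vassilevska Williams, Y. Xu, Z. Xu, R. Zhou, *New bounds for matrix multiplication: from alpha
  to omega*, SODA 2024, arXiv:2307.07970, Cor. 4.2 (fixing holes), Prop. 5.1.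
  [VassilevskaWilliamsXuXuZhou2024]
-/

noncomputable section

open scoped BigOperators
open Finset

namespace Literature.Computability.AlgebraicComplexity

open Literature.Barriers.MatrixMultiplication (bigCwTensor)

namespace GlobalStageData

open scoped Classical

universe u

variable {c n M : ℕ} (D : GlobalStageData c n M)

/-- The number `M_Y` of level-1 `Y`-blocks of `𝒯*_T` (useful `Y`-sequences in `Y_J`). [cite: AlmanDuanVassilevskaWilliamsXuXuZhou2025, Thm. 4.2 (hole fractions in all three dimensions) and Claim 5.12] -/
abbrev usefulYCount (T : (Fin n → Fin (2 * c + 1)) × (Fin n → Fin (2 * c + 1)) × (Fin n → Fin (2 * c + 1))) : ℕ :=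
  (univ.filter fun Jh : Fin n → Fin c → Fin 3 => blockOfSeq Jh = T.2.1 ∧ D.UsefulY T Jh).card

namespace MoreAsym

/-- **The good copies**: triples of `𝒯_hash` whose copy of `𝒯*` has at most `h_Y` `Y`-holes and at most
`h_Z` `Z`-holes. [cite: AlmanDuanVassilevskaWilliamsXuXuZhou2025, §5.5 ("a broken copy of 𝒯* whose fraction of holes is ≤ 1/8N in all three dimensions")] -/
abbrev goodTriples (ω : VxxzSeed M n) (hY hZ : ℕ) :
    Finset ((Fin n → Fin (2 * c + 1)) × (Fin n → Fin (2 * c + 1)) × (Fin n → Fin (2 * c + 1))) :=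
  (D.hashTriples ω).filter fun T => (holesY D ω T).card ≤ hY ∧ (holesZ D ω T).card ≤ hZ

variable {D}

/-! ## Relabelling a copy onto the reference copy -/

/-- Transporting a hole set along a chunk permutation: `w ∈ σ⁻¹(H)` iff `σ w ∈ H`. [folklore] -/
theorem mem_image_chunkPerm_symm_iff (σ : Equiv.Perm (Fin n)) (H : Finset (Fin n → Fin c → Fin 3))
    (w : Fin n → Fin c → Fin 3) : w ∈ H.image (chunkPerm σ.symm) ↔ chunkPerm σ w ∈ H := by
  have hcancel : ∀ v : Fin n → Fin c → Fin 3, chunkPerm σ.symm (chunkPerm σ v) = v := by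
    intro v; funext u; simp
  have hcancel' : ∀ v : Fin n → Fin c → Fin 3, chunkPerm σ (chunkPerm σ.symm v) = v := by
    intro v; funext u; simp
  rw [mem_image]
  constructor
  · rintro ⟨K, hK, hKe⟩
    have : chunkPerm σ w = K := by rw [← hKe, hcancel']
    rw [this]; exact hK
  · intro hmem
    exact ⟨chunkPerm σ w, hmem, hcancel _⟩

/-- **Every copy restricts to a broken reference copy with as many holes**: for `α`-consistent block
triples `T, T₀` and hole sets `H_Y` (level-1 `Y`-sequences), `H_Z` (level-1 `Z`-sequences), the broken copy
of `𝒯*_T` with these holes restricts to the broken copy of `𝒯*_{T₀}` with hole sets of the same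
cardinalities (transport along the chunk permutation relating the two term maps).
[cite: AlmanDuanVassilevskaWilliamsXuXuZhou2025, §5.5 ("independent broken copies of 𝒯*") and Def. 4.1] -/
theorem brokenCopy_restrictsTo_refCopy (hD : D.WellFormed) (R : Type u) [CommSemiring R] (q : ℕ)
    {T T₀ : (Fin n → Fin (2 * c + 1)) × (Fin n → Fin (2 * c + 1)) × (Fin n → Fin (2 * c + 1))}
    (hT : T ∈ D.𝒯α) (hT₀ : T₀ ∈ D.𝒯α) (HY HZ : Finset (Fin n → Fin c → Fin 3)) :
    ∃ HY₀ HZ₀ : Finset (Fin n → Fin c → Fin 3), HY₀.card = HY.card ∧ HZ₀.card = HZ.card ∧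
      TensorRestrictsTo (partSubtensor levelSeq levelSeq levelSeq (D.starTensor R q T) univ HYᶜ HZᶜ)
        (partSubtensor levelSeq levelSeq levelSeq (D.starTensor R q T₀) univ HY₀ᶜ HZ₀ᶜ) := by
  have hlev := isLevelTriple_of_mem_tripleSet (hD.subset hT)
  have hlev₀ := isLevelTriple_of_mem_tripleSet (hD.subset hT₀)
  have htype := letterCount_tripleTermMap_eq_of_isAlphaConsistent hlev₀ hlev
    (hD.alphaConsistent _ hT₀) (hD.alphaConsistent _ hT)
  obtain ⟨σ, hσ⟩ := exists_perm_of_letterCount_eq htype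
  have hτ : tripleTermMap hlev = tripleTermMap hlev₀ ∘ ⇑σ.symm := by
    funext v
    have := hσ (σ.symm v)
    simp only [Equiv.apply_symm_apply] at this
    simp only [Function.comp_apply]
    exact this
  refine ⟨HY.image (chunkPerm σ.symm), HZ.image (chunkPerm σ.symm),
    card_image_of_injective _ (chunkPerm σ.symm).injective,
    card_image_of_injective _ (chunkPerm σ.symm).injective, ?_⟩
  have key : partSubtensor levelSeq levelSeq levelSeq (D.starTensor R q T₀) univ
      (HY.image (chunkPerm σ.symm))ᶜ (HZ.image (chunkPerm σ.symm))ᶜ =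
      fun x y z => partSubtensor levelSeq levelSeq levelSeq (D.starTensor R q T) univ HYᶜ HZᶜ
        (chunkPerm σ x) (chunkPerm σ y) (chunkPerm σ z) := by
    funext x y z
    simp only [starTensor, usefulSubtensor_eq_interfaceTensor R q hlev, usefulSubtensor_eq_interfaceTensor R q hlev₀,
      partSubtensor_apply, mem_univ, true_and, mem_compl, hτ, interfaceTensor_relabel, levelSeq_chunkPerm,
      mem_image_chunkPerm_symm_iff]
  rw [key]
  exact TensorRestrictsTo.comap _ _ _ _

/-- The number of useful `Y`-sequences of a block triple of `𝒯` is the number `M_Y` of level-1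
`Y`-blocks of its interface tensor `𝒯*_T`. [cite: AlmanDuanVassilevskaWilliamsXuXuZhou2025, Claim 5.12 and Thm. 4.2] -/
theorem usefulYCount_eq_card_levelBlocksY
    {T : (Fin n → Fin (2 * c + 1)) × (Fin n → Fin (2 * c + 1)) × (Fin n → Fin (2 * c + 1))}
    (hT : T ∈ D.tripleSet) :
    D.usefulYCount T = (levelBlocksY (tripleTermMap (isLevelTriple_of_mem_tripleSet hT))
      (tripleTermList c D.γX D.γY D.γZ) 0).card := by
  unfold usefulYCount
  congr 1
  ext Jh
  rw [mem_filter, mem_levelBlocksY_triple_iff, chunkLevels_eq_iff]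
  simp [UsefulY]

/-- **The power restricts to `k` independent copies of `𝒯*`** (§5.5, last paragraph, in exact form): if
`k · r ≤ #good triples of 𝒯_hash(ω)`, `r ≥ 8^{3⌊log_{2N} 3^N⌋+3}` (`N = cn`, the count of Thm. 4.2 /
VXXZ Cor. 4.2) and `8 N h_Y ≤ M_Y(T)`, `8 N h_Z ≤ M_Z(T)` for the `α`-consistent triples, then for every
reference `T₀ ∈ 𝒯α`, `(CW_q^{⊗c})^{⊗n} ≥ ⟨k⟩ ⊗ 𝒯*_{T₀}` — zero-out to `𝒯_ZUseful`, decompose into the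
copies over the triples of `𝒯_hash`, keep `k` batches of `r` good copies, relabel each onto `T₀` and fix
its `Y`- and `Z`-holes by Thm. 4.2.
[cite: AlmanDuanVassilevskaWilliamsXuXuZhou2025, §5.5 ("by Theorem 4.2, we can degenerate them into numalpha · M^{-1-o(1)} unbroken copies of 𝒯*") and Prop. 5.1] -/
theorem power_restrictsTo_copies (hD : WellFormed D) (R : Type u) [CommSemiring R] (q : ℕ)
    (hc : 0 < c) (hn : 0 < n) (ω : VxxzSeed M n) {hY hZ k r : ℕ}
    (hr : 8 ^ (3 * Nat.log (2 * (c * n)) (3 ^ (c * n)) + 3) ≤ r)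
    (hkr : k * r ≤ (goodTriples D ω hY hZ).card)
    (hhY : ∀ T ∈ D.𝒯α, 8 * (c * n) * hY ≤ D.usefulYCount T)
    (hhZ : ∀ T ∈ D.𝒯α, 8 * (c * n) * hZ ≤ D.usefulZCount T)
    {T₀ : (Fin n → Fin (2 * c + 1)) × (Fin n → Fin (2 * c + 1)) × (Fin n → Fin (2 * c + 1))}
    (hT₀ : T₀ ∈ D.𝒯α) :
    TensorRestrictsTo (kroneckerPow (kroneckerPow (bigCwTensor R q) c) n)
      (kroneckerTensor (unitTensor R k) (D.starTensor R q T₀)) := by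
  have hD' : D.WellFormed := hD.toWellFormed
  have hlev₀ := isLevelTriple_of_mem_tripleSet (hD'.subset hT₀)
  -- (1) zero-out to `𝒯_ZUseful` and (2) the direct sum over the triples of `𝒯_hash`
  have h1 : TensorRestrictsTo (kroneckerPow (kroneckerPow (bigCwTensor R q) c) n) (finalTensor D R q ω) :=
    tensorRestrictsTo_partSubtensor _ _ _ _ _ _ _
  have h2 := finalTensor_restrictsTo_directSum R q hD ω
  -- (3) `k · r` good copies, indexed by `Fin k × Fin r`
  set g := (goodTriples D ω hY hZ).card with hg
  let eg : Fin g ≃ ↥(goodTriples D ω hY hZ) := (Fintype.equivFinOfCardEq (Fintype.card_coe _)).symm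
  have hgood_sub : goodTriples D ω hY hZ ⊆ D.hashTriples ω := filter_subset _ _
  let j : Fin k × Fin r → ↥(goodTriples D ω hY hZ) := fun p => eg (Fin.castLE hkr (finProdFinEquiv p))
  have hj : Function.Injective j := fun p p' hpp' =>
    finProdFinEquiv.injective (Fin.castLE_injective hkr (eg.injective hpp'))
  let ι : Fin k × Fin r → ↥(D.hashTriples ω) := fun p => ⟨(j p).1, hgood_sub (j p).2⟩
  have hι : Function.Injective ι := by
    intro p p' hpp'
    have h' : (ι p).1 = (ι p').1 := congrArg Subtype.val hpp'
    exact hj (Subtype.ext (show (j p).1 = (j p').1 from h'))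
  have hιgood : ∀ p, (ι p).1 ∈ goodTriples D ω hY hZ := fun p => (j p).2
  have h3 : TensorRestrictsTo (familyDirectSum fun T : ↥(D.hashTriples ω) => summand D R q ω T)
      (familyDirectSum fun p : Fin k × Fin r => summand D R q ω (ι p)) :=
    familyDirectSum_reindex _ hι
  have h4 : TensorRestrictsTo (familyDirectSum fun p : Fin k × Fin r => summand D R q ω (ι p))
      (familyDirectSum fun a : Fin k => familyDirectSum fun b : Fin r => summand D R q ω (ι (a, b))) :=
    familyDirectSum_prod fun a b => summand D R q ω (ι (a, b))
  -- (4) each copy restricts to a broken reference copy with at most `h_Y` + `h_Z` holes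
  have hcopy : ∀ (a : Fin k) (b : Fin r), ∃ HY₀ HZ₀ : Finset (Fin n → Fin c → Fin 3),
      HY₀.card ≤ hY ∧ HZ₀.card ≤ hZ ∧
      TensorRestrictsTo (summand D R q ω (ι (a, b)))
        (partSubtensor levelSeq levelSeq levelSeq (D.starTensor R q T₀) univ HY₀ᶜ HZ₀ᶜ) := by
    intro a b
    have hgd := hιgood (a, b)
    obtain ⟨hpres, hholesY, hholesZ⟩ := mem_filter.1 hgd
    have hTα : (ι (a, b)).1 ∈ D.𝒯α := xPresentTriples_subset hpres
    obtain ⟨HY₀, HZ₀, hcardY, hcardZ, hres⟩ :=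
      brokenCopy_restrictsTo_refCopy hD' R q hTα hT₀ (holesY D ω (ι (a, b)).1) (holesZ D ω (ι (a, b)).1)
    refine ⟨HY₀, HZ₀, hcardY ▸ hholesY, hcardZ ▸ hholesZ, ?_⟩
    rw [summand_eq_brokenCopy R q hD' (ι (a, b))]
    exact hres
  choose HY₀ HZ₀ hHY₀card hHZ₀card hH₀ using hcopy
  -- (5) Thm. 4.2 (fixing holes) on each batch
  have hbatch : ∀ a : Fin k, TensorRestrictsTo (familyDirectSum fun b : Fin r => summand D R q ω (ι (a, b)))
      (D.starTensor R q T₀) := by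
    intro a
    refine (familyDirectSum_mono fun b => hH₀ a b).trans ?_
    have hstar : D.starTensor R q T₀ =
        interfaceTensor R q (tripleTermMap hlev₀) (tripleTermList c D.γX D.γY D.γZ) 0 :=
      usefulSubtensor_eq_interfaceTensor R q hlev₀ _ _ _
    have e1 : (fun b : Fin r => partSubtensor levelSeq levelSeq levelSeq (D.starTensor R q T₀) univ (HY₀ a b)ᶜ (HZ₀ a b)ᶜ) =
        fun b : Fin r => partSubtensor levelSeq levelSeq levelSeq
          (interfaceTensor R q (tripleTermMap hlev₀) (tripleTermList c D.γX D.γY D.γZ) 0)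
          ((fun _ : Fin r => (∅ : Finset (Fin n → Fin c → Fin 3))) b)ᶜ (HY₀ a b)ᶜ (HZ₀ a b)ᶜ := by
      funext b
      rw [hstar, compl_empty]
    rw [e1, hstar]
    refine vxxz2024_cor42 R q hc hn (tripleTermMap hlev₀) (tripleTermList c D.γX D.γY D.γZ)
      (fun _ => ∅) (HY₀ a) (HZ₀ a) (fun _ => by simp) (fun b => ?_) (fun b => ?_) hr
    · calc 8 * (c * n) * (HY₀ a b).card ≤ 8 * (c * n) * hY := Nat.mul_le_mul_left _ (hHY₀card a b)
        _ ≤ D.usefulYCount T₀ := hhY T₀ hT₀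
        _ = _ := usefulYCount_eq_card_levelBlocksY (hD'.subset hT₀)
    · calc 8 * (c * n) * (HZ₀ a b).card ≤ 8 * (c * n) * hZ := Nat.mul_le_mul_left _ (hHZ₀card a b)
        _ ≤ D.usefulZCount T₀ := hhZ T₀ hT₀
        _ = _ := usefulZCount_eq_card_levelBlocksZ (hD'.subset hT₀)
  have h5 : TensorRestrictsTo
      (familyDirectSum fun a : Fin k => familyDirectSum fun b : Fin r => summand D R q ω (ι (a, b)))
      (kroneckerTensor (unitTensor R k) (D.starTensor R q T₀)) := by
    rw [← familyDirectSum_const]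
    exact familyDirectSum_mono hbatch
  exact h1.trans (h2.trans (h3.trans (h4.trans h5)))

variable [Fact M.Prime]

/-- **ADVXXZ Proposition 5.1, one region, exact form.**  Let `D` be well-formed data of the first region
(`MoreAsym.WellFormed`: `α`-consistency of `𝒯α ⊆ 𝒯` and Remark 5.2), `M` an odd prime with `2c < M`,
`n, c ≥ 1`, `B ⊆ ℤ/M` without non-trivial 3-term progressions, and assume the requirements on `M` of
§5.2 and §5.5 in counting form: `8|𝒯| ≤ M |typeClass μX|` (cleanup) and, for every `T ∈ 𝒯α`,
`10 U_Y(T) M^{n−1} ≤ (h_Y+1) M^n`, `10 U_Z(T) M^{n−1} ≤ (h_Z+1) M^n` (holes) together with the hole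
budgets `8 N h_Y ≤ M_Y(T)`, `8 N h_Z ≤ M_Z(T)` of Thm. 4.2.  Then for every `r ≥ 8^{3⌊log_{2N} 3^N⌋+3}`
and every reference triple `T₀ ∈ 𝒯α`,
`(CW_q^{⊗c})^{⊗n} ≥ ⟨⌊|B| |𝒯α| / (2 M² r)⌋⟩ ⊗ 𝒯*_{T₀}` — the printed "`numalpha · M₀^{-1-o(1)}` independent
copies of a level-`ℓ` interface tensor `𝒯*`" of one region with all constants explicit (`𝒯*_{T₀}` is the
interface tensor with parameter list `{(|S_{i,j,k}|, i, j, k, β_{X,i,j,k}, β_{Y,i,j,k}, β_{Z,i,j,k})}`,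
`usefulSubtensor_eq_interfaceTensor`).  The choice of `M₀` (eq. (M₀ final)), the six-region product
(§5.1) and the exponents `E_r` are not part of this statement.
[cite: AlmanDuanVassilevskaWilliamsXuXuZhou2025, Prop. 5.1 and §5.5–§5.6] -/
theorem advxxz2025_prop51_region (hD : WellFormed D) (R : Type u) [CommSemiring R] (q : ℕ)
    (hM : M ≠ 2) (hcM : 2 * c < M) (hc : 0 < c) (hn : 0 < n) (hB : ThreeAPFree (D.B : Set (ZMod M)))
    (h8X : 8 * D.tripleSet.card ≤ M * (typeClass n D.μX).card) {hY hZ : ℕ}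
    (hUY : ∀ T ∈ D.𝒯α, 10 * ((D.holePairsY T).card * M ^ (n - 1)) ≤ (hY + 1) * M ^ n)
    (hUZ : ∀ T ∈ D.𝒯α, 10 * ((D.holePairs T).card * M ^ (n - 1)) ≤ (hZ + 1) * M ^ n)
    (hhY : ∀ T ∈ D.𝒯α, 8 * (c * n) * hY ≤ D.usefulYCount T)
    (hhZ : ∀ T ∈ D.𝒯α, 8 * (c * n) * hZ ≤ D.usefulZCount T) {r : ℕ}
    (hr : 8 ^ (3 * Nat.log (2 * (c * n)) (3 ^ (c * n)) + 3) ≤ r)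
    {T₀ : (Fin n → Fin (2 * c + 1)) × (Fin n → Fin (2 * c + 1)) × (Fin n → Fin (2 * c + 1))}
    (hT₀ : T₀ ∈ D.𝒯α) :
    TensorRestrictsTo (kroneckerPow (kroneckerPow (bigCwTensor R q) c) n)
      (kroneckerTensor (unitTensor R (D.B.card * D.𝒯α.card / (2 * M ^ 2 * r))) (D.starTensor R q T₀)) := by
  obtain ⟨ω, hω⟩ := exists_seed_many_good_copies hD.toWellFormed hM hcM hn hB h8X hUY hUZ
  refine power_restrictsTo_copies hD R q hc hn ω hr ?_ hhY hhZ hT₀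
  rcases Nat.eq_zero_or_pos r with rfl | hrpos
  · simp
  have hMpos : 0 < M := Nat.Prime.pos Fact.out
  have h2M : 0 < 2 * M ^ 2 := by positivity
  calc D.B.card * D.𝒯α.card / (2 * M ^ 2 * r) * r
      = D.B.card * D.𝒯α.card / (2 * M ^ 2) / r * r := by rw [Nat.div_div_eq_div_mul]
    _ ≤ D.B.card * D.𝒯α.card / (2 * M ^ 2) := Nat.div_mul_le_self _ _
    _ ≤ (goodTriples D ω hY hZ).card := by
        rw [Nat.div_le_iff_le_mul_add_pred h2M]
        exact hω.trans (Nat.le_add_right _ _)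

end MoreAsym

end GlobalStageData

end Literature.Computability.AlgebraicComplexity
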